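import Mathlib

/-!
# An 8-letter affine elementary word for `E_13(x₀x₁x₂)` (Ben-Or–Cleve needs 10)

`E_12(x₂)·E_21(x₀)·E_13(x₁)·E_21(-x₀)·E_12(-x₂)·E_21(x₀)·E_13(-x₁)·E_21(-x₀) = E_13(x₀x₁x₂)`
in `SL₃(ℤ[x₀,x₁,x₂])`, i.e. `[E_12(x₂), T]` with `T = E_21(x₀)E_13(x₁)E_21(-x₀) = E_13(x₁)E_23(x₀x₁)`:
the garbage `E_13(x₁)` is central in the upper unitriangular group and commutes away.
Kernel-checked below over an arbitrary commutative ring.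
-/

open Matrix MvPolynomial

namespace ShortWord

variable {R : Type*} [CommRing R]

/-- elementary letter `E_ij(c) = 1 + c • e_ij` as an explicit 3×3 matrix -/
def E (i j : Fin 3) (c : R) : Matrix (Fin 3) (Fin 3) R := Matrix.transvection i j c

theorem eight_letter_word (a b c : R) :
    E 0 1 c * E 1 0 a * E 0 2 b * E 1 0 (-a) * E 0 1 (-c) * E 1 0 a * E 0 2 (-b) * E 1 0 (-a)
      = E 0 2 (a * b * c) := by
  ext i j
  fin_cases i <;> fin_cases j <;>
    simp [E, Matrix.transvection, Matrix.mul_apply, Fin.sum_univ_three, Matrix.one_apply,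
      Matrix.single] <;> ring

/-- The same identity for the generic monomial in `MvPolynomial (Fin 3) ℂ`, in the route's letter
format `Matrix.transvection i j (C λ * X v)`. -/
theorem eight_letter_word_X :
    (Matrix.transvection (0 : Fin 3) 1 (C (1:ℂ) * X (2 : Fin 3)) *
     Matrix.transvection (1 : Fin 3) 0 (C (1:ℂ) * X (0 : Fin 3)) *
     Matrix.transvection (0 : Fin 3) 2 (C (1:ℂ) * X (1 : Fin 3)) *
     Matrix.transvection (1 : Fin 3) 0 (C (-1:ℂ) * X (0 : Fin 3)) *
     Matrix.transvection (0 : Fin 3) 1 (C (-1:ℂ) * X (2 : Fin 3)) *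
     Matrix.transvection (1 : Fin 3) 0 (C (1:ℂ) * X (0 : Fin 3)) *
     Matrix.transvection (0 : Fin 3) 2 (C (-1:ℂ) * X (1 : Fin 3)) *
     Matrix.transvection (1 : Fin 3) 0 (C (-1:ℂ) * X (0 : Fin 3)))
      = Matrix.transvection (0 : Fin 3) 2 (X 0 * X 1 * X 2 : MvPolynomial (Fin 3) ℂ) := by
  have h := eight_letter_word (R := MvPolynomial (Fin 3) ℂ) (X 0) (X 1) (X 2)
  simpa [E, map_neg, map_one, neg_mul, one_mul] using h

/-- **The mechanism (central garbage is free).** For the commutator that manufactures degree,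
only `E_12`'s (1,2)-slot and the partner's (2,3)-slot matter: arbitrary garbage `h` in the central
(1,3)-slot of the left factor and `b` in the (1,3)-slot of the right factor commutes away. -/
theorem dirty_commutator (a h b G : R) :
    (E 0 1 a * E 0 2 h) * (E 0 2 b * E 1 2 G) * (E 0 1 a * E 0 2 h)⁻¹ * (E 0 2 b * E 1 2 G)⁻¹
      = E 0 2 (a * G) := by
  have h1 : (E 0 1 a * E 0 2 h)⁻¹ = E 0 2 (-h) * E (0:Fin 3) 1 (-a) := by
    rw [Matrix.inv_eq_right_inv]
    ext i j
    fin_cases i <;> fin_cases j <;>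
      simp [E, Matrix.transvection, Matrix.mul_apply, Fin.sum_univ_three, Matrix.one_apply,
        Matrix.single] <;> ring
  have h2 : (E 0 2 b * E 1 2 G)⁻¹ = E 1 2 (-G) * E (0:Fin 3) 2 (-b) := by
    rw [Matrix.inv_eq_right_inv]
    ext i j
    fin_cases i <;> fin_cases j <;>
      simp [E, Matrix.transvection, Matrix.mul_apply, Fin.sum_univ_three, Matrix.one_apply,
        Matrix.single] <;> ring
  rw [h1, h2]
  ext i j
  fin_cases i <;> fin_cases j <;>
    simp [E, Matrix.transvection, Matrix.mul_apply, Fin.sum_univ_three, Matrix.one_apply,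
      Matrix.single] <;> ring

/-- Right slot in 3 letters: `E_21(c)·E_13(b)·E_21(-c) = E_13(b)·E_23(b c)` (one conjugation
instead of the 4-letter commutator for `E_23(bc)`). -/
theorem right_slot (b c : R) :
    E 1 0 c * E 0 2 b * E 1 0 (-c) = E 0 2 b * E 1 2 (b * c) := by
  ext i j
  fin_cases i <;> fin_cases j <;>
    simp [E, Matrix.transvection, Matrix.mul_apply, Fin.sum_univ_three, Matrix.one_apply,
      Matrix.single] <;> ring

/-- Left slot: `E_32(1-x)·E_23(-1)·E_12(a)·E_23(1)·E_32(x-1) = E_12(a x)·E_13(a)` — two variable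
letters carrying `x` (each `E_32(±(x-1))` is `E_32(∓1)·E_32(±x)` in the letter model) around a clean `E_12(a)`. -/
theorem left_slot (a x : R) :
    E 2 1 (1 - x) * E 1 2 (-1) * E 0 1 a * E 1 2 1 * E 2 1 (x - 1) = E 0 1 (a * x) * E 0 2 a := by
  ext i j
  fin_cases i <;> fin_cases j <;>
    simp [E, Matrix.transvection, Matrix.mul_apply, Fin.sum_univ_three, Matrix.one_apply,
      Matrix.single] <;> ring

/-- Twelve VARIABLE letters for `E_13(x₀x₁x₂x₃)` (Ben-Or–Cleve: 16). Here `E 2 1 (1 - x₁)` abbreviates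
the two commuting letters `E_32(1)·E_32(-x₁)` of the route's letter model (a letter carries `λ` or `λ·x_v`),
so as a word this is 12 variable letters and 12 constant letters. -/
theorem twelve_letter_word (x₀ x₁ x₂ x₃ : R) :
    (E 2 1 (1 - x₁) * E 1 2 (-1) * E 0 1 x₀ * E 1 2 1 * E 2 1 (x₁ - 1)) *
    (E 1 0 x₂ * E 0 2 x₃ * E 1 0 (-x₂)) *
    (E 2 1 (1 - x₁) * E 1 2 (-1) * E 0 1 (-x₀) * E 1 2 1 * E 2 1 (x₁ - 1)) *
    (E 1 0 x₂ * E 0 2 (-x₃) * E 1 0 (-x₂))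
      = E 0 2 (x₀ * x₁ * x₂ * x₃) := by
  ext i j
  fin_cases i <;> fin_cases j <;>
    simp [E, Matrix.transvection, Matrix.mul_apply, Fin.sum_univ_three, Matrix.one_apply,
      Matrix.single] <;> ring

end ShortWord
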